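import Summits.HodgeConjecture.HodgeConjecture.Theorems.MarkmanPartnerTransportK3Sq2OneCycleIsometries
import Summits.HodgeConjecture.HodgeConjecture.Theorems.MarkmanPartnerTransportIsometrySpannedThirdOfThreeFacts
import Literature.AlgebraicGeometry.HodgeTheory.DiagonalSymmetryStability

/-!
# Route MarkmanPartnerTransport · HC⁴ for marked `K3^{[2]}`-type fourfolds WITH COMPLEX MULTIPLICATION,
# modulo {Verbitsky–Guan, Charles–Markman 2013, Markman 2024}

Corollaries of `spannedByIsometries_of_cm` (`…K3Sq2OneCycleIsometries`: a rational endomorphism of `H²(X(ℂ); ℂ)`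
preserving type `(1,1)` with a NON-REAL eigenvalue on the symplectic form forces the route clause
`SpannedByIsometries X φ`) and of item #3 `IsometrySpannedThird` (tree theorem
`isometrySpannedThird_of_three_facts`, prover g12/19716-p2: HC⁴(X) for every marked `X` whose transcendental Hodge
endomorphisms are spanned by isometries, modulo the three named facts):

* `hodgeConjectureFor_of_cm_of_isometrySpannedThird` — granted `IsometrySpannedThird`, a marked smooth projective
  `K3^{[2]}`-type `X` with complex multiplication (in the coordinate sense `CMX`) satisfies HC⁴(X);
* `hodgeConjectureFor_of_cm_of_three_facts` — the same modulo {Verbitsky–Guan, Charles–Markman 2013, Markman 2024};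
* `hodgeConjectureFor_of_endomorphism_nonreal{,_of_three_facts}` — in particular **a marked smooth projective
  `K3^{[2]}`-type `X` admitting an algebraic self-map `g : X ⟶ X` with `g^* σ = μ σ`, `μ ∉ ℝ` (e.g. a
  non-symplectic automorphism of order `≥ 3`) satisfies HC⁴(X)**, modulo the three facts (`g^*` is rational,
  `IsRationalClass.pullback`, and type-preserving, `IsOfHodgeType.map_endomorphism`).

CONDITIONAL on the displayed named facts; no definition, no sorry. Prover seat hodge-nonav-19652-p1 (gen 8),
`--supports stmt-HodgeConjecture-19653`. Nothing here proves the crux or HC.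

References: E. Markman, Compos. Math. 160 (2024) Thm. 1.1; F. Charles–E. Markman, Compos. Math. 149 (2013) Thm. 1.1;
Yu. Zarhin, J. reine angew. Math. 341 (1983) Thm. 1.6; D. Huybrechts, *Lectures on K3 Surfaces*, Ch. 3 Thm. 3.3.7;
S. Boissière–C. Camere–A. Sarti, *Classification of automorphisms on a deformation family of hyper-Kähler
four-folds by p-elementary lattices*, Kyoto J. Math. 56 (2016) (non-symplectic automorphisms of prime order).
-/

noncomputable section

set_option linter.dupNamespace false

open Module CategoryTheory MonoidalCategory
open Literature.AlgebraicTopology.SingularHomology Literature.Geometry.Kaehler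
open Literature.AlgebraicGeometry Literature.AlgebraicGeometry.Motives Literature.AlgebraicGeometry.HodgeTheory
open Literature.AlgebraicGeometry.Hyperkaehler Literature.AlgebraicGeometry.Surfaces
open Summit.HodgeConjecture.HodgeConjecture.Theorems.NikulinTwinTransport

namespace Summit.HodgeConjecture.HodgeConjecture.Theorems.MarkmanPartnerTransport.PartnerLattice

/-- `MarkedK3Sq[X, φ, P, z]`: VERBATIM the `let MarkedK3Sq := …` binder of the route declarations of
MarkmanPartnerTransport (clauses (m1)–(m6)). Local notation only. -/
local notation3 (prettyPrint := false) "MarkedK3Sq[" X ", " φ ", " P ", " z "]" =>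
  (((IsIntegralClass P ∧ ∀ Q : complexBetti X (2 * 4), IsIntegralClass Q → ∃ n : ℤ, Q = n • P) ∧
    (∀ c : complexBetti X 2, IsIntegralClass c ↔ ∃ v : K3HilbertIndex → ℤ, φ c = fun i => (v i : ℂ)) ∧
    (∀ a : complexBetti X 2, cupPowTwo a 4 = ((3 : ℂ) * (k3HilbertForm 2 (φ a) (φ a)) ^ 2) • P) ∧
    (IsOfHodgeType 4 X 2 2 0 (LinearEquiv.symm φ z) ∧
      ∀ τ : complexBetti X 2, IsOfHodgeType 4 X 2 2 0 τ → ∃ t : ℂ, τ = t • LinearEquiv.symm φ z) ∧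
    (∀ c : complexBetti X 2, IsOfHodgeType 4 X 2 1 1 c ↔
      (k3HilbertForm 2 (φ c) z = 0 ∧ k3HilbertForm 2 (φ c) (star z) = 0)) ∧
    (k3HilbertForm 2 z z = 0 ∧ 0 < (k3HilbertForm 2 (star z) z).re)))

variable {X : SchemeOver ℂ} {φ : complexBetti X 2 ≃ₗ[ℂ] (K3HilbertIndex → ℂ)} {P : complexBetti X (2 * 4)}
  {z : K3HilbertIndex → ℂ}

/-- **HC⁴ for a marked `K3^{[2]}`-type fourfold with complex multiplication, granted `IsometrySpannedThird`**: a
rational endomorphism `Ψ` of `H²(X(ℂ); ℂ)` preserving type `(1,1)` with `Ψ σ = μ σ`, `μ ∉ ℝ`, forces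
`SpannedByIsometries X φ` (`spannedByIsometries_of_cm`), and item #3 concludes.
[cite: Zarhin1983HodgeGroupsK3, Thm. 1.6] [cite: Markman2024, §1.1 Thm. 1.1] -/
theorem hodgeConjectureFor_of_cm_of_isometrySpannedThird
    (hIS : Summit.HodgeConjecture.HodgeConjecture.Theses.MarkmanPartnerTransport.IsometrySpannedThird)
    (hX : IsSmoothProjective 4 X) (hK : IsOfK3HilbertSquareType X) (hM : MarkedK3Sq[X, φ, P, z])
    (Ψ : complexBetti X 2 →ₗ[ℂ] complexBetti X 2) (hΨrat : ∀ y, IsRationalClass y → IsRationalClass (Ψ y))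
    (hΨ11 : ∀ y, IsOfHodgeType 4 X 2 1 1 y → IsOfHodgeType 4 X 2 1 1 (Ψ y)) {μ : ℂ}
    (hΨσ : Ψ (φ.symm z) = μ • φ.symm z) (hμ : μ.im ≠ 0) : HodgeConjectureFor 4 X :=
  hIS X hX hK φ P z hM (spannedByIsometries_of_cm hX hM Ψ hΨrat hΨ11 hΨσ hμ)

/-- **HC⁴ for a marked `K3^{[2]}`-type fourfold with complex multiplication, modulo {Verbitsky–Guan,
Charles–Markman 2013, Markman 2024}** (`isometrySpannedThird_of_three_facts`). CONDITIONAL; credits nothing.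
[cite: CharlesMarkman2013, Thm. 1.1 (§1)] [cite: Markman2024, §1.1 Thm. 1.1] [cite: Zarhin1983HodgeGroupsK3, Thm. 1.6] -/
theorem hodgeConjectureFor_of_cm_of_three_facts
    (hV : VerbitskyGuan_cohomology_K3HilbertSquareType) (hB : CharlesMarkman2013_lefschetzStandard_K3HilbertType)
    (hMk : Markman2024_rationalHodgeIsometry_algebraic_marked)
    (hX : IsSmoothProjective 4 X) (hK : IsOfK3HilbertSquareType X) (hM : MarkedK3Sq[X, φ, P, z])
    (Ψ : complexBetti X 2 →ₗ[ℂ] complexBetti X 2) (hΨrat : ∀ y, IsRationalClass y → IsRationalClass (Ψ y))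
    (hΨ11 : ∀ y, IsOfHodgeType 4 X 2 1 1 y → IsOfHodgeType 4 X 2 1 1 (Ψ y)) {μ : ℂ}
    (hΨσ : Ψ (φ.symm z) = μ • φ.symm z) (hμ : μ.im ≠ 0) : HodgeConjectureFor 4 X :=
  hodgeConjectureFor_of_cm_of_isometrySpannedThird (isometrySpannedThird_of_three_facts hV hB hMk) hX hK hM Ψ hΨrat
    hΨ11 hΨσ hμ

/-- **An algebraic self-map acting on the symplectic form by a non-real scalar gives HC⁴(X), granted
`IsometrySpannedThird`**: for `g : X ⟶ X` (e.g. a non-symplectic automorphism of order `≥ 3`), `g^*` on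
`H²(X(ℂ); ℂ)` is rational (`IsRationalClass.pullback`) and type-preserving (`IsOfHodgeType.map_endomorphism`), so
`g^* σ = μ σ` with `μ ∉ ℝ` is complex multiplication. [cite: VoisinHodgeI2002, §7.3.2] [cite: Zarhin1983HodgeGroupsK3, Thm. 1.6]
[cite: Markman2024, §1.1 Thm. 1.1] -/
theorem hodgeConjectureFor_of_endomorphism_nonreal
    (hIS : Summit.HodgeConjecture.HodgeConjecture.Theses.MarkmanPartnerTransport.IsometrySpannedThird)
    (hX : IsSmoothProjective 4 X) (hK : IsOfK3HilbertSquareType X) (hM : MarkedK3Sq[X, φ, P, z]) (g : X ⟶ X) {μ : ℂ}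
    (hg : complexBetti.map g 2 (φ.symm z) = μ • φ.symm z) (hμ : μ.im ≠ 0) : HodgeConjectureFor 4 X :=
  hodgeConjectureFor_of_cm_of_isometrySpannedThird hIS hX hK hM (complexBetti.map g 2).hom
    (fun _ hy => hy.pullback _) (fun _ hy => hy.map_endomorphism hX g) hg hμ

/-- **An algebraic self-map acting on the symplectic form by a non-real scalar gives HC⁴(X), modulo
{Verbitsky–Guan, Charles–Markman 2013, Markman 2024}.** CONDITIONAL; credits nothing.
[cite: CharlesMarkman2013, Thm. 1.1 (§1)] [cite: Markman2024, §1.1 Thm. 1.1] [cite: VoisinHodgeI2002, §7.3.2] -/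
theorem hodgeConjectureFor_of_endomorphism_nonreal_of_three_facts
    (hV : VerbitskyGuan_cohomology_K3HilbertSquareType) (hB : CharlesMarkman2013_lefschetzStandard_K3HilbertType)
    (hMk : Markman2024_rationalHodgeIsometry_algebraic_marked)
    (hX : IsSmoothProjective 4 X) (hK : IsOfK3HilbertSquareType X) (hM : MarkedK3Sq[X, φ, P, z]) (g : X ⟶ X) {μ : ℂ}
    (hg : complexBetti.map g 2 (φ.symm z) = μ • φ.symm z) (hμ : μ.im ≠ 0) : HodgeConjectureFor 4 X :=
  hodgeConjectureFor_of_endomorphism_nonreal (isometrySpannedThird_of_three_facts hV hB hMk) hX hK hM g hg hμ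

end Summit.HodgeConjecture.HodgeConjecture.Theorems.MarkmanPartnerTransport.PartnerLattice

end
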